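import Mathlib.Combinatorics.Hall.Basic
import Summits.Ventures.PercRepro.RankLevelSetHallComplement

/-!
# PercRepro — THE LOAD LEMMA IMPLIES C-044 UP AT THE TIGHT LAYER (via Hall's marriage theorem)
(p4, gen 39; paper proofs/P4-TILT-S.md §7; C-044 at the tight layer `#E = p + q`, any `k = p − q ≥ 2`)

By the complement identity (RankLevelSetHallComplement) C-044 UP follows from an injection of the LOST sets of the cell into its
BIG sets with `T ⊆ μ(T)`.  THIS FILE reduces that injection to a LOCAL statement.  For a lost set `T` let `extP(T)` be its
extensions of size exactly `p` that meet `cl T` only in `T` (`extP`); every such extension is a big UP-neighbour of the cell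
(`extP_subset_bigUpSets`: rank `≤ q + (p − #T) < p`, `> q`), and `extP(T)` is nonempty (`extP_nonempty`).  Give every `B ∈ extP(T)`
the weight `1/#extP(T)` (`extWeight`): each lost set receives exactly `1`.  **THE LOAD LEMMA** (`LoadLemma`, a `Prop`, NOT asserted)
says that every `B ⊆ E` of size `p` receives at most `1` from its SECTIONS — the lost sets `T` with `B ∩ cl T = T` (`sectionsOf`).
Then a double count gives Hall's condition for the bipartite graph `T ~ B ∈ extP(T)` (`hall_of_loadLemma`), Hall's marriage theorem
(`Finset.all_card_le_biUnion_card_iff_exists_injective`) gives the injection (`lostBigInj_of_loadLemma`), and the complement identity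
gives **C-044 UP for every family** (`hallUp_of_loadLemma`).  Evidence (p4 g39, lbload.py): the maximal load is `0.700` on the random
`n ≤ 12` census, `0.333` on the fat-class family, `0.450` on the kernel-A killers; kit j336638 climbs against it.

* `extP`, `extP_finite`, `subset_of_mem_extP`, `lostUpSets_finite`, `extP_subset_bigUpSets`, `extP_nonempty`;
* `sectionsOf`, `sectionsOf_finite`, `extWeight`, `LoadLemma`;
* `hall_of_loadLemma`, **`lostBigInj_of_loadLemma`**, **`hallUp_of_loadLemma`**.
Axioms: standard.
-/

namespace PercRepro

open Set Matroid Finset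

variable {α : Type} (M : Matroid α) [M.Finite]

/-- The size-`p` extensions of `T` meeting `cl T` only in `T`: `B ⊆ E`, `#B = p`, `B ∩ cl T = T`. -/
def extP (p : ℕ) (T : Set α) : Set (Set α) := {B | B ⊆ M.E ∧ B.ncard = p ∧ B ∩ M.closure T = T}

/-- `extP(T)` is finite. -/
theorem extP_finite (p : ℕ) (T : Set α) : (extP M p T).Finite :=
  M.ground_finite.finite_subsets.subset (fun _ h => h.1)

omit [M.Finite] in
/-- An extension contains `T`. -/
theorem subset_of_mem_extP {p : ℕ} {T B : Set α} (hB : B ∈ extP M p T) : T ⊆ B := by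
  rw [← hB.2.2]
  exact inter_subset_left

/-- The lost sets of a family form a finite family. -/
theorem lostUpSets_finite (p q : ℕ) (𝒜 : Set (Set α)) : (lostUpSets M p q 𝒜).Finite :=
  M.ground_finite.finite_subsets.subset (fun _ h => h.1)

/-- **Every size-`p` extension of a lost set is a big UP-neighbour of the cell.** -/
theorem extP_subset_bigUpSets (p q : ℕ) {T : Set α}
    (hT : T ∈ lostUpSets M p q (cellMembers M p q)) : extP M p T ⊆ bigUpSets M p q (cellMembers M p q) := by
  intro B hB
  obtain ⟨hBE, hBp, hBT⟩ := hB
  obtain ⟨hTE, hqT, hTp, hrkT, Z, hZ, hZT⟩ := hT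
  have hTB : T ⊆ B := subset_of_mem_extP M ⟨hBE, hBp, hBT⟩
  have hBfin : B.Finite := M.set_finite B hBE
  have hTfin : T.Finite := M.set_finite T hTE
  -- rank below `p`: `r(B) ≤ r(T) + #(B ∖ T) = q + (p − #T) < p`
  have hcard := ncard_sdiff_add_ncard_of_subset hTB hBfin
  have hlt : M.eRk B < (p : ℕ∞) := by
    have h1 : M.eRk B ≤ M.eRk T + (B \ T).encard := by
      have := M.eRk_union_le_eRk_add_encard T (B \ T)
      rwa [union_sdiff_cancel hTB] at this
    rw [hrkT, ← (hBfin.subset sdiff_subset).cast_ncard_eq] at h1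
    have h2 : ((q + (B \ T).ncard : ℕ) : ℕ∞) < (p : ℕ∞) := by
      exact_mod_cast (show q + (B \ T).ncard < p by omega)
    push_cast at h2
    exact lt_of_le_of_lt h1 h2
  -- rank above `q`: otherwise `cl T = cl B`, so `B ⊆ cl T`, so `B = B ∩ cl T = T`, contradicting `#T < p = #B`
  have hgt : (q : ℕ∞) < M.eRk B := by
    have hge : (q : ℕ∞) ≤ M.eRk B := by rw [← hrkT]; exact M.eRk_mono hTB
    refine lt_of_le_of_ne hge (fun heq => ?_)
    have hcl : M.closure T = M.closure B :=
      (M.isRkFinite_of_finite hTfin).closure_eq_closure_of_subset_of_eRk_ge_eRk hTB (by rw [← heq, hrkT])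
    have hBcl : B ⊆ M.closure T := by rw [hcl]; exact M.subset_closure B hBE
    have hBeq : B = T := by rw [← hBT]; exact (inter_eq_left.mpr hBcl).symm
    rw [hBeq] at hBp
    omega
  exact ⟨⟨hBE, hgt, hlt, Z, hZ, hZT.trans hTB⟩, hBp.ge⟩

/-- The closure of a rank-`q` set containing a member `Z` is `cl Z`. -/
theorem closure_eq_closure_of_rank_q (p q : ℕ) {Z T : Set α} (hZ : Z ∈ cellMembers M p q) (hZT : Z ⊆ T)
    (hT : M.eRk T = (q : ℕ∞)) : M.closure T = M.closure Z := by
  have hZfin : Z.Finite := M.set_finite Z hZ.1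
  exact ((M.isRkFinite_of_finite hZfin).closure_eq_closure_of_subset_of_eRk_ge_eRk hZT
    (by rw [hT, hZ.2.1])).symm

/-- `#(cl Z ∖ Z) ≤ q` for a member `Z` at the tight layer (it is independent inside the rank-`q` flat `cl Z`). -/
theorem ncard_closure_sdiff_le (p q : ℕ) (hE : M.E.ncard = p + q) {Z : Set α} (hZ : Z ∈ cellMembers M p q) :
    (M.closure Z \ Z).ncard ≤ q := by
  have hind : M.Indep (M.closure Z \ Z) :=
    (compl_indep_of_mem_U M hE hZ).1.subset (fun x hx => ⟨M.closure_subset_ground Z hx.1, hx.2⟩)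
  have hfin : (M.closure Z \ Z).Finite := M.set_finite _ (sdiff_subset.trans (M.closure_subset_ground Z))
  have h := hind.encard_le_eRk_of_subset (sdiff_subset : M.closure Z \ Z ⊆ M.closure Z)
  rw [M.eRk_closure_eq, hZ.2.1, ← hfin.cast_ncard_eq] at h
  exact_mod_cast h

/-- **Every lost set has an extension**: `E ∖ cl T` has `≥ p − q > p − #T` elements, and `T ∪ U` for a `(p − #T)`-subset `U`
of `E ∖ cl T` is one. -/
theorem extP_nonempty (p q : ℕ) (hE : M.E.ncard = p + q) {T : Set α}
    (hT : T ∈ lostUpSets M p q (cellMembers M p q)) : (extP M p T).Nonempty := by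
  obtain ⟨hTE, hqT, hTp, hrkT, Z, hZ, hZT⟩ := hT
  have hcl : M.closure T = M.closure Z := closure_eq_closure_of_rank_q M p q hZ hZT hrkT
  have hZE : Z ⊆ M.E := hZ.1
  have hZq : Z.ncard = q := ncard_eq_q_of_mem_cellMembers_tight M hE hZ
  have hFE : M.closure Z ⊆ M.E := M.closure_subset_ground Z
  have hFfin : (M.closure Z).Finite := M.set_finite _ hFE
  have hZF : Z ⊆ M.closure Z := M.subset_closure Z hZE
  have h1 := ncard_sdiff_add_ncard_of_subset hZF hFfin
  have h2 := ncard_closure_sdiff_le M p q hE hZ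
  have h3 := ncard_sdiff_add_ncard_of_subset hFE M.ground_finite
  have hω : p - T.ncard ≤ (M.E \ M.closure Z).ncard := by omega
  obtain ⟨U, hUsub, hUcard⟩ := Set.exists_subset_card_eq hω
  have hUE : U ⊆ M.E := hUsub.trans sdiff_subset
  have hUF : Disjoint U (M.closure Z) := Set.disjoint_left.mpr (fun x hx hxF => (hUsub hx).2 hxF)
  have hTF : T ⊆ M.closure Z := by rw [← hcl]; exact M.subset_closure T hTE
  refine ⟨T ∪ U, union_subset hTE hUE, ?_, ?_⟩
  · rw [ncard_union_eq (Set.disjoint_of_subset_left hTF hUF.symm) (M.set_finite T hTE) (M.set_finite U hUE), hUcard]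
    omega
  · rw [hcl, union_inter_distrib_right, inter_eq_left.mpr hTF, (Set.disjoint_iff_inter_eq_empty.mp hUF), union_empty]

/-- The SECTIONS of `B`: the lost sets `T` of the cell with `B ∩ cl T = T`. -/
def sectionsOf (p q : ℕ) (B : Set α) : Set (Set α) :=
  {T | T ∈ lostUpSets M p q (cellMembers M p q) ∧ B ∩ M.closure T = T}

/-- The sections of `B` form a finite family. -/
theorem sectionsOf_finite (p q : ℕ) (B : Set α) : (sectionsOf M p q B).Finite :=
  (lostUpSets_finite M p q _).subset (fun _ h => h.1)

/-- The uniform extension weight `1/#extP(T)`. -/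
noncomputable def extWeight (p : ℕ) (T : Set α) : ℚ := 1 / ((extP M p T).ncard : ℚ)

/-- **THE LOAD LEMMA** (a `Prop`, NOT asserted): every `B ⊆ E` of size `p` receives at most `1` from its sections under the
uniform extension weights. -/
def LoadLemma (p q : ℕ) : Prop :=
  ∀ B : Set α, B ⊆ M.E → B.ncard = p → ∑ T ∈ (sectionsOf_finite M p q B).toFinset, extWeight M p T ≤ 1

/-- A lost set receives exactly `1` from its extensions. -/
theorem sum_extWeight_eq_one (p q : ℕ) (hE : M.E.ncard = p + q) {T : Set α}
    (hT : T ∈ lostUpSets M p q (cellMembers M p q)) :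
    ∑ _B ∈ (extP_finite M p T).toFinset, extWeight M p T = 1 := by
  have hcard : ((extP M p T).ncard : ℚ) = ((extP_finite M p T).toFinset.card : ℚ) := by
    rw [Set.ncard_eq_toFinset_card _ (extP_finite M p T)]
  have hpos : (0 : ℚ) < ((extP_finite M p T).toFinset.card : ℚ) := by
    have : 0 < (extP_finite M p T).toFinset.card := by
      rw [Finset.card_pos, Set.Finite.toFinset_nonempty]
      exact extP_nonempty M p q hE hT
    exact_mod_cast this
  rw [Finset.sum_const, nsmul_eq_mul]
  simp only [extWeight]
  rw [hcard]
  field_simp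

open Classical in
/-- **Hall's condition from the load lemma**: for every finset `s` of lost sets, `#s ≤ #(⋃_{T ∈ s} extP(T))`. -/
theorem hall_of_loadLemma (p q : ℕ) (hE : M.E.ncard = p + q) (hL : LoadLemma M p q)
    (s : Finset (Set α)) (hs : ∀ T ∈ s, T ∈ lostUpSets M p q (cellMembers M p q)) :
    s.card ≤ (s.biUnion (fun T => (extP_finite M p T).toFinset)).card := by
  set U : Finset (Set α) := s.biUnion (fun T => (extP_finite M p T).toFinset) with hU
  have hcast : (s.card : ℚ) ≤ (U.card : ℚ) := by
    calc (s.card : ℚ) = ∑ T ∈ s, (1 : ℚ) := by simp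
      _ = ∑ T ∈ s, ∑ _B ∈ (extP_finite M p T).toFinset, extWeight M p T := by
          apply Finset.sum_congr rfl
          intro T hT
          rw [sum_extWeight_eq_one M p q hE (hs T hT)]
      _ = ∑ B ∈ U, ∑ T ∈ s.filter (fun T => B ∈ (extP_finite M p T).toFinset), extWeight M p T := by
          apply Finset.sum_comm'
          intro T B
          constructor
          · rintro ⟨hT, hB⟩
            exact ⟨Finset.mem_filter.mpr ⟨hT, hB⟩, Finset.mem_biUnion.mpr ⟨T, hT, hB⟩⟩
          · rintro ⟨hT, -⟩
            exact ⟨(Finset.mem_filter.mp hT).1, (Finset.mem_filter.mp hT).2⟩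
      _ ≤ ∑ B ∈ U, ∑ T ∈ (sectionsOf_finite M p q B).toFinset, extWeight M p T := by
          apply Finset.sum_le_sum
          intro B _
          apply Finset.sum_le_sum_of_subset_of_nonneg
          · intro T hT
            obtain ⟨hTs, hTB⟩ := Finset.mem_filter.mp hT
            rw [Set.Finite.mem_toFinset] at hTB ⊢
            exact ⟨hs T hTs, hTB.2.2⟩
          · intro T _ _
            unfold extWeight
            positivity
      _ ≤ ∑ _B ∈ U, (1 : ℚ) := by
          apply Finset.sum_le_sum
          intro B hB
          obtain ⟨T, hT, hBT⟩ := Finset.mem_biUnion.mp hB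
          rw [Set.Finite.mem_toFinset] at hBT
          exact hL B hBT.1 hBT.2.1
      _ = (U.card : ℚ) := by simp
  exact_mod_cast hcast

/-- **The injection from the load lemma** (Hall's marriage theorem). -/
theorem lostBigInj_of_loadLemma (p q : ℕ) (hE : M.E.ncard = p + q) (hL : LoadLemma M p q) : LostBigInj M p q := by
  classical
  set L : Finset (Set α) := (lostUpSets_finite M p q (cellMembers M p q)).toFinset with hLdef
  have hmemL : ∀ T, T ∈ L ↔ T ∈ lostUpSets M p q (cellMembers M p q) := fun T => by
    rw [hLdef, Set.Finite.mem_toFinset]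
  let t : {T // T ∈ L} → Finset (Set α) := fun T => (extP_finite M p T.1).toFinset
  have hhall : ∀ s : Finset {T // T ∈ L}, s.card ≤ (s.biUnion t).card := by
    intro s
    have h1 : s.card = (s.image Subtype.val).card :=
      (Finset.card_image_of_injective s Subtype.val_injective).symm
    have h2 : (s.image Subtype.val).biUnion (fun T => (extP_finite M p T).toFinset) = s.biUnion t :=
      Finset.image_biUnion
    rw [h1, ← h2]
    apply hall_of_loadLemma M p q hE hL
    intro T hT
    obtain ⟨T', -, rfl⟩ := Finset.mem_image.mp hT
    exact (hmemL T'.1).mp T'.2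
  obtain ⟨f, hfinj, hft⟩ := (Finset.all_card_le_biUnion_card_iff_exists_injective t).mp hhall
  refine ⟨fun T => if h : T ∈ L then f ⟨T, h⟩ else T, ?_, ?_⟩
  · intro T hT
    have hTL : T ∈ L := (hmemL T).mpr hT
    simp only [hTL, dite_true]
    have hmem : f ⟨T, hTL⟩ ∈ extP M p T := by
      have := hft ⟨T, hTL⟩
      rwa [Set.Finite.mem_toFinset] at this
    exact ⟨extP_subset_bigUpSets M p q hT hmem, subset_of_mem_extP M hmem⟩
  · intro T₁ hT₁ T₂ hT₂ heq
    have h₁ : T₁ ∈ L := (hmemL T₁).mpr hT₁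
    have h₂ : T₂ ∈ L := (hmemL T₂).mpr hT₂
    simp only [h₁, h₂, dite_true] at heq
    have := hfinj heq
    exact congrArg Subtype.val this

/-- **C-044 UP AT THE TIGHT LAYER FROM THE LOAD LEMMA**: the UP-Hall condition for every family of members. -/
theorem hallUp_of_loadLemma (p q : ℕ) (hE : M.E.ncard = p + q) (hL : LoadLemma M p q) (𝒜 : Set (Set α))
    (h𝒜 : 𝒜 ⊆ cellMembers M p q) :
    phiK p q * (𝒜.ncard : ℚ) ≤ ((upNbhd M p q 𝒜).ncard : ℚ) :=
  hallUp_of_lostBigInj M p q hE (lostBigInj_of_loadLemma M p q hE hL) 𝒜 h𝒜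

end PercRepro
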